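import Summits.Ventures.LatticeQCDFlow.Exactness.IMHAcceptMonotone
import HarnessLib

/-!
# The equilibrium acceptance of flow-MCMC never exceeds its hot-start acceptance

HONEST FRAMING: exact (Metropolis-corrected) sampling algorithms for lattice gauge theory;
figures of merit are autocorrelation/cost numbers at stated couplings and volumes; no
continuum-physics claim.

Venture `LatticeQCDFlow` (cell pub-lqcd), topic `Exactness`; FANOUT row 30 (lean-1, GEN-31).  NEW WORK of the
cell, general state space.  Two averages of the acceptance mass `A(x) = ∫ min{1, w(y)/w(x)} q(dy)` of the
flow-MCMC kernel `K = indepMH q w` (`π = w·q` normalised) are in use: the EQUILIBRIUM acceptance `∫ A dπ` (the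
number a long run reports) and the HOT-START acceptance `∫ A dq` (the first step from a fresh model draw; at least
`1/2` by `IMHHotStartAcceptance`, this generation).  GEN-28 `IMHAcceptMonotone` showed `A` is ANTITONE in the
weight of the current state; `π` re-weights `q` by that very weight.  A monotone function and an antitone function
of the same quantity are negatively correlated (Chebyshev's sum inequality, proved here by the symmetric
double-integral trick `∫∫ (w(x) − w(y))(A(y) − A(x)) q(dx) q(dy) ≥ 0`), hence:

* **`integral_mul_imhAcceptMass_le`** — `∫ A·w dq ≤ (∫ A dq)·(∫ w dq)`, i.e. for the normalised weight
  (**`integral_imhAcceptMass_target_le_model`**) `∫ A dπ ≤ ∫ A dq`: THE EQUILIBRIUM ACCEPTANCE NEVER EXCEEDS THE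
  HOT-START ACCEPTANCE — a long exact-sampler run accepts less often than its first step did, for every model and
  every target.

Reading: for the exact gauge samplers the reported (equilibrium) acceptance is a LOWER estimate of the hot-start
acceptance and an upper one is trivial; the cold start's acceptance `A(cold)` is the minimum of `A` (GEN-28
`AutoregressiveGaugeColdStickiest`), below both averages.  NOT CLAIMED: any quantitative gap between the two
averages.

No `sorry`, no new definitions, nothing cited as a fact.
-/

noncomputable section

namespace Summit.Ventures.LatticeQCDFlow.Exactness

open MeasureTheory ProbabilityTheory Function
open scoped ENNReal

variable {Ω : Type*} [MeasurableSpace Ω]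
variable {q : Measure Ω} [IsProbabilityMeasure q] {w : Ω → ℝ}

/-- **Chebyshev for the acceptance mass**: `∫ A·w dq ≤ (∫ A dq)·(∫ w dq)` for every measurable positive `q`-integrable
weight `w` — the acceptance mass is antitone in the weight, so the two are negatively correlated under `q`. [ours] -/
theorem integral_mul_imhAcceptMass_le (hw : Measurable w) (hw0 : ∀ y, 0 < w y) (hwi : Integrable w q) :
    ∫ x, (imhAcceptMass q w x).toReal * w x ∂q ≤ (∫ x, (imhAcceptMass q w x).toReal ∂q) * ∫ x, w x ∂q := by
  set a : Ω → ℝ := fun x => (imhAcceptMass q w x).toReal with ha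
  have ham : Measurable a := (measurable_imhAcceptMass q hw).ennreal_toReal
  have ha0 : ∀ x, 0 ≤ a x := fun x => ENNReal.toReal_nonneg
  have ha1 : ∀ x, a x ≤ 1 := fun x => by
    have h := ENNReal.toReal_mono ENNReal.one_ne_top (imhAcceptMass_le_one q w x)
    rwa [ENNReal.toReal_one] at h
  have hanti : ∀ x y, w y ≤ w x → a x ≤ a y := fun x y hle =>
    ENNReal.toReal_mono (ne_top_of_le_ne_top ENNReal.one_ne_top (imhAcceptMass_le_one q w y))
      (imhAcceptMass_anti hw0 hle)
  have habound : ∀ᵐ x ∂q, ‖a x‖ ≤ 1 := ae_of_all _ fun x => by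
    rw [Real.norm_eq_abs, abs_of_nonneg (ha0 x)]; exact ha1 x
  have hai : Integrable a q := (integrable_const (1 : ℝ)).mono' ham.aestronglyMeasurable habound
  have hawi : Integrable (fun x => a x * w x) q := hwi.bdd_mul ham.aestronglyMeasurable habound
  -- the symmetric double integral is nonnegative
  set F : Ω × Ω → ℝ := fun z => (w z.1 - w z.2) * (a z.2 - a z.1) with hF
  have hF0 : ∀ z, 0 ≤ F z := by
    intro z
    rcases le_total (w z.2) (w z.1) with h | h
    · exact mul_nonneg (sub_nonneg.2 h) (sub_nonneg.2 (hanti z.1 z.2 h))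
    · exact mul_nonneg_of_nonpos_of_nonpos (sub_nonpos.2 h) (sub_nonpos.2 (hanti z.2 z.1 h))
  have hFnonneg : 0 ≤ ∫ z, F z ∂(q.prod q) := integral_nonneg hF0
  -- expand it into four product integrals
  have h1 : Integrable (fun z : Ω × Ω => w z.1 * a z.2) (q.prod q) := hwi.mul_prod hai
  have h2 : Integrable (fun z : Ω × Ω => (a z.1 * w z.1) * (1 : ℝ)) (q.prod q) :=
    hawi.mul_prod (integrable_const (1 : ℝ))
  have h3 : Integrable (fun z : Ω × Ω => (1 : ℝ) * (a z.2 * w z.2)) (q.prod q) :=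
    (integrable_const (1 : ℝ)).mul_prod hawi
  have h4 : Integrable (fun z : Ω × Ω => a z.1 * w z.2) (q.prod q) := hai.mul_prod hwi
  have h12 : Integrable (fun z : Ω × Ω => w z.1 * a z.2 - (a z.1 * w z.1) * (1 : ℝ)) (q.prod q) := h1.sub h2
  have h123 : Integrable (fun z : Ω × Ω => w z.1 * a z.2 - (a z.1 * w z.1) * (1 : ℝ) - (1 : ℝ) * (a z.2 * w z.2))
      (q.prod q) := h12.sub h3
  have hFexp : F = fun z : Ω × Ω =>
      w z.1 * a z.2 - (a z.1 * w z.1) * (1 : ℝ) - (1 : ℝ) * (a z.2 * w z.2) + a z.1 * w z.2 := by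
    funext z
    simp only [hF]
    ring
  have hexp : ∫ z, F z ∂(q.prod q) =
      (∫ z : Ω × Ω, w z.1 * a z.2 ∂(q.prod q)) - (∫ z : Ω × Ω, (a z.1 * w z.1) * (1 : ℝ) ∂(q.prod q)) -
        (∫ z : Ω × Ω, (1 : ℝ) * (a z.2 * w z.2) ∂(q.prod q)) + ∫ z : Ω × Ω, a z.1 * w z.2 ∂(q.prod q) := by
    rw [hFexp, integral_add h123 h4, integral_sub h12 h3, integral_sub h1 h2]
  have hI1 : ∫ z : Ω × Ω, w z.1 * a z.2 ∂(q.prod q) = (∫ x, w x ∂q) * ∫ x, a x ∂q := integral_prod_mul w a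
  have hI2 : ∫ z : Ω × Ω, (a z.1 * w z.1) * (1 : ℝ) ∂(q.prod q) = ∫ x, a x * w x ∂q := by
    rw [integral_prod_mul (fun x => a x * w x) (fun _ => (1 : ℝ)), integral_const, probReal_univ, one_smul, mul_one]
  have hI3 : ∫ z : Ω × Ω, (1 : ℝ) * (a z.2 * w z.2) ∂(q.prod q) = ∫ x, a x * w x ∂q := by
    rw [integral_prod_mul (fun _ => (1 : ℝ)) (fun x => a x * w x), integral_const, probReal_univ, one_smul, one_mul]
  have hI4 : ∫ z : Ω × Ω, a z.1 * w z.2 ∂(q.prod q) = (∫ x, a x ∂q) * ∫ x, w x ∂q := integral_prod_mul a w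
  rw [hexp, hI1, hI2, hI3, hI4] at hFnonneg
  nlinarith [hFnonneg]

/-- **THE EQUILIBRIUM ACCEPTANCE NEVER EXCEEDS THE HOT-START ACCEPTANCE**: for the normalised weight
(`π = w·q` a probability law), `∫ A dπ ≤ ∫ A dq`. [ours] -/
theorem integral_imhAcceptMass_target_le_model (hw : Measurable w) (hw0 : ∀ y, 0 < w y)
    [IsProbabilityMeasure (q.withDensity fun y => ENNReal.ofReal (w y))] :
    ∫ x, (imhAcceptMass q w x).toReal ∂(q.withDensity fun y => ENNReal.ofReal (w y)) ≤
      ∫ x, (imhAcceptMass q w x).toReal ∂q := by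
  have hlin : ∫⁻ x, ENNReal.ofReal (w x) ∂q = 1 := by
    have h : (q.withDensity fun y => ENNReal.ofReal (w y)) Set.univ = 1 := measure_univ
    rwa [withDensity_apply _ MeasurableSet.univ, Measure.restrict_univ] at h
  have hwi : Integrable w q := by
    refine ⟨hw.aestronglyMeasurable, ?_⟩
    show ∫⁻ x, ‖w x‖ₑ ∂q < ⊤
    simp_rw [Real.enorm_eq_ofReal (hw0 _).le]
    rw [hlin]
    exact ENNReal.one_lt_top
  have hIw : ∫ x, w x ∂q = 1 := by
    rw [integral_eq_lintegral_of_nonneg_ae (ae_of_all _ fun x => (hw0 x).le) hw.aestronglyMeasurable, hlin,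
      ENNReal.toReal_one]
  have hπa : ∫ x, (imhAcceptMass q w x).toReal ∂(q.withDensity fun y => ENNReal.ofReal (w y)) =
      ∫ x, (imhAcceptMass q w x).toReal * w x ∂q := by
    rw [integral_withDensity_eq_integral_toReal_smul hw.ennreal_ofReal (ae_of_all _ fun x => ENNReal.ofReal_lt_top)]
    refine integral_congr_ae (ae_of_all _ fun x => ?_)
    simp only
    rw [ENNReal.toReal_ofReal (hw0 x).le, smul_eq_mul, mul_comm]
  rw [hπa]
  have h := integral_mul_imhAcceptMass_le (q := q) hw hw0 hwi
  rwa [hIw, mul_one] at h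

end Summit.Ventures.LatticeQCDFlow.Exactness
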